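import Summits.ABC.IUTFork.Conditional.AbcOfSHwindowFreyRefutationPrelims
import HarnessLib

/-!
# Branch C / R-W «C:HSHW-REF», per-datum preliminaries (sequel): the DEGREE-FORM depth locus is EMPTY at a rational `λ`-line point under a
# PER-PRIME TABLE `−ord_p(j(λ))·(l−3) ≤ (16 + 8·k_p)·l` with `p^{k_p} ≤ N₀ ≤ [K:ℚ]` — the form needed when several bad local heights exceed `16`

PROOF-ONLY support file (D-0012; 0 definitions, 0 `Prop` facts, no instance, no notation) of the abc-iut cell (seat abc-iut-w6-d102, gen 3; sequel of
`AbcOfSHwindowFreyRefutationPrelims`, p465405). TAKES NO SIDE on [IUTchIII] Cor. 3.12 (S. Mochizuki, *Inter-universal Teichmüller theory III*, RIMS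
manuscript, Cor. 3.12 p. 173–174) or on any author: bookkeeping over OUR typed objects (the CHOSEN realising q-idele of `pilotDataOfK T.D T.K`).

WHAT IS PROVED. `GenuineK.not_degreeDeep_ratPoint_of_table` — for `l` prime `≥ 5`, a genuine Θ-volume datum `T` over `(ratPoint λ, l)` with
`N₀ ≤ [K:ℚ]`, and at EVERY finite place `v` of `ℚ` a natural number `k` with `p_v^k ≤ N₀` and `−ord_v(j(λ))·(l−3) ≤ (16 + 8k)·l`: NO prime `p > 2`, label
index `i` and fibre point `x₀ | p` satisfy `p^{((i+2)(4 + 2·log_p[K:ℚ]) + 1)}·‖t_{q,x₀}‖^{(i+1)²−1} < 1` (the antecedent of `hSHwBad` in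
`Conditional.abc_of_SH_v10K_window_szpiroBadAll`, VERBATIM). It subsumes p465405's `…not_degreeDeep_ratPoint` (`k = 0` off `3`, `k = 1` at `3`, `N₀ = 3`)
and serves the rows where more than one bad local height exceeds `16` (e.g. the tier-1 triple at `l = 17`: `h_3 = 30` needs `k_3 = 2`, `h_5 = 20` needs
`k_5 = 1`, with `N₀ = 17 ≤ [K:ℚ]`). Proof = p465405 §3 with `log_p[K:ℚ] ≥ k` from `p^k ≤ N₀ ≤ [K:ℚ]` (Mathlib `Real.le_logb_iff_rpow_le`).
HONEST SCOPE: bookkeeping; nothing about the printed inequality of [IUTchIII] Cor. 3.12 or `Cor22.Cor312AtDatum`; typed ≠ proved; no abc claim.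
[cite: Mochizuki2012, IUTchIV Prop. 1.2 p. 10, Cor. 2.2 (ii) proof (P2)(P5) p. 45–46; IUTchI Ex. 3.2 (iv) p. 71] [cite: DupuyHilado2025, §3.3, §3.4]
[claim: Mochizuki2012, status: disputed] for every IUT quotation.
-/

noncomputable section

open Set Function NumberField IsDedekindDomain

namespace Summit.ABC.IUTFork.Conditional

open Thm311 Thm311.Real Cor312 Cor312Prov Literature.IUT.LogVolume Literature.IUT.HodgeTheaters
  Literature.IUT.LogThetaLattice Literature.NumberTheory.NumberFields Literature.NumberTheory.DiophantineGeometry.GenEll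
  Literature.NumberTheory.DiophantineGeometry

variable {q : ℚ} {l : ℕ} (T : Cor22.ThetaVolumeDatumAt (ratPoint q) l)

/-- **The degree-form depth locus is EMPTY under a per-prime table.** For `l` prime `≥ 5`, a genuine Θ-volume datum `T` over `(ratPoint λ, l)` with
`N₀ ≤ [K:ℚ]`, and at every finite place `v` of `ℚ` some `k ∈ ℕ` with `p_v^k ≤ N₀` and `−ord_v(j(λ))·(l−3) ≤ (16 + 8k)·l`: no `p > 2`, `i`, `x₀ | p` has
`p^{((i+2)(4 + 2·log_p[K:ℚ]) + 1)}·‖t_{q,x₀}‖^{(i+1)²−1} < 1` (off the bad set `‖t_{q,x₀}‖ = 1`; at a bad place `‖t_{q,x₀}‖ = p^{ord_p(j(λ))/(2l)}`,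
`(M/(2l))·i ≤ M(l−3)/(4l) ≤ 4 + 2k ≤ 4 + 2·log_p[K:ℚ]`). [cite: Mochizuki2012, IUTchIV Prop. 1.2 p. 10, Cor. 2.2 (P2) p. 45] [claim: Mochizuki2012, status: disputed] -/
theorem GenuineK.not_degreeDeep_ratPoint_of_table (hl : l.Prime) (h5 : 5 ≤ l) (N₀ : ℕ)
    (hord : ∀ v : HeightOneSpectrum (𝓞 ℚ), ∃ k : ℕ, Rat.HeightOneSpectrum.natGenerator v ^ k ≤ N₀ ∧
      -(Literature.IUT.LogVolume.ord ℚ v (Cor22.jInv q)) * ((l : ℤ) - 3) ≤ (16 + 8 * k) * l)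
    (hK : letI := T.instFieldF; letI := T.instNumberFieldF; letI := T.instAlgebraF; letI := T.instFieldK
    letI := T.instNumberFieldK; letI := T.instAlgebraK; letI := T.instFieldFbar; letI := T.instAlgebraFbar
    letI := T.instAlgebraKFbar; letI := T.instIsElliptic
      N₀ ≤ Module.finrank ℚ T.K) :
    letI := T.instFieldF; letI := T.instNumberFieldF; letI := T.instAlgebraF; letI := T.instFieldK
    letI := T.instNumberFieldK; letI := T.instAlgebraK; letI := T.instFieldFbar; letI := T.instAlgebraFbar
    letI := T.instAlgebraKFbar; letI := T.instIsElliptic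
    ¬ (∃ (pp : Nat.Primes) (_ : 2 < (pp : ℕ)) (i : Fin (thetaIndex (pilotDataOfK T.D T.K)).lstar)
          (x₀ : (thetaIndex (pilotDataOfK T.D T.K)).Fibre (.inr pp)),
        haveI : Fact (pp : ℕ).Prime := ⟨pp.2⟩
        ((pp : ℕ) : ℝ) ^ ((((i : ℕ) : ℝ) + 2) * (4 + 2 * Real.logb (pp : ℕ) (Module.finrank ℚ T.K)) + 1) *
          ‖(exists_realising_qIdeles_pilotDataOfK T.D).choose pp x₀‖ ^ (((i : ℕ) + 1) ^ 2 - 1) < 1) := by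
  letI := T.instFieldF; letI := T.instNumberFieldF; letI := T.instAlgebraF; letI := T.instFieldK
  letI := T.instNumberFieldK; letI := T.instAlgebraK; letI := T.instFieldFbar; letI := T.instAlgebraFbar
  letI := T.instAlgebraKFbar; letI := T.instIsElliptic
  rintro ⟨pp, hp2, i, x₀, hlt⟩
  haveI : Fact (pp : ℕ).Prime := ⟨pp.2⟩
  have hp1 : (1 : ℝ) < ((pp : ℕ) : ℝ) := by exact_mod_cast pp.2.one_lt
  have hp0 : (0 : ℝ) < ((pp : ℕ) : ℝ) := lt_trans zero_lt_one hp1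
  have hK1 : (1 : ℝ) ≤ (Module.finrank ℚ T.K : ℝ) := by exact_mod_cast Module.finrank_pos
  have hKpos : (0 : ℝ) < (Module.finrank ℚ T.K : ℝ) := lt_of_lt_of_le zero_lt_one hK1
  have hL0 : 0 ≤ Real.logb ((pp : ℕ) : ℝ) (Module.finrank ℚ T.K : ℝ) := Real.logb_nonneg hp1 hK1
  -- the label index: `2i + 3 ≤ l`
  have hodd : l % 2 = 1 := by
    rcases hl.eq_two_or_odd with h | h
    · omega
    · exact h
  have hlstar : (thetaIndex (pilotDataOfK T.D T.K)).lstar = (l - 1) / 2 := rfl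
  have hi : 2 * (i : ℕ) + 3 ≤ l := by
    have h1 : (i : ℕ) < (thetaIndex (pilotDataOfK T.D T.K)).lstar := i.2
    omega
  have hiR : 2 * ((i : ℕ) : ℝ) + 3 ≤ (l : ℝ) := by exact_mod_cast hi
  have hi0 : (0 : ℝ) ≤ ((i : ℕ) : ℝ) := Nat.cast_nonneg _
  have hB : ((((i : ℕ) + 1) ^ 2 - 1 : ℕ) : ℝ) = ((i : ℕ) : ℝ) * (((i : ℕ) : ℝ) + 2) := by
    have : 1 ≤ ((i : ℕ) + 1) ^ 2 := Nat.one_le_pow _ _ (by omega)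
    push_cast [Nat.cast_sub this]
    ring
  have hA0 : 0 ≤ (((i : ℕ) : ℝ) + 2) * (4 + 2 * Real.logb ((pp : ℕ) : ℝ) (Module.finrank ℚ T.K : ℝ)) + 1 := by positivity
  by_cases hS : placeOf (pilotDataOfK T.D T.K) pp.1 x₀ ∈ (pilotDataOfK T.D T.K).S
  · -- a bad place: `‖t_{q,x₀}‖ = p^{ord_{v₀}(j(λ))/(2l)}`
    set v₀ : HeightOneSpectrum (𝓞 ℚ) :=
      finBelow (ratPoint q).F T.F (finBelow T.F T.K (placeOf (pilotDataOfK T.D T.K) pp.1 x₀)) with hv₀def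
    have hgen := GenuineK.natGenerator_eq_of_eq_finBelow_placeOf T pp x₀ v₀ hv₀def
    obtain ⟨hnorm, -⟩ := GenuineK.norm_qIdele_chosen_ratPoint T pp x₀ v₀ hv₀def hS
    obtain ⟨k, hkN, hordk⟩ := hord v₀
    rw [hgen] at hkN
    -- `log_p [K:ℚ] ≥ k`
    have hLk : (k : ℝ) ≤ Real.logb ((pp : ℕ) : ℝ) (Module.finrank ℚ T.K : ℝ) := by
      rw [Real.le_logb_iff_rpow_le hp1 hKpos, Real.rpow_natCast]
      exact_mod_cast hkN.trans hK
    -- the exponent is nonnegative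
    rw [hnorm, ← Real.rpow_natCast, ← Real.rpow_mul hp0.le, ← Real.rpow_add hp0, hB] at hlt
    refine absurd hlt (not_lt.mpr (Real.one_le_rpow hp1.le ?_))
    set t : ℝ := (Literature.IUT.LogVolume.ord ℚ v₀ (Cor22.jInv q) : ℝ) with ht
    set L : ℝ := Real.logb ((pp : ℕ) : ℝ) (Module.finrank ℚ T.K : ℝ) with hL
    have hl0 : (0 : ℝ) < l := by exact_mod_cast hl.pos
    have hl3 : (0 : ℝ) < (l : ℝ) - 3 := by
      have : (5 : ℝ) ≤ l := by exact_mod_cast h5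
      linarith
    have hordR : -t * ((l : ℝ) - 3) ≤ (16 + 8 * (k : ℝ)) * l := by
      rw [ht]; exact_mod_cast hordk
    -- `c := -t/(2l)` (the pole order over `2l`, possibly negative); `c·i ≤ 4 + 2k`
    have hkey : -t / (2 * l) * ((i : ℕ) : ℝ) ≤ 4 + 2 * (k : ℝ) := by
      rw [div_mul_eq_mul_div, div_le_iff₀ (by positivity)]
      by_cases ht0 : 0 ≤ -t
      · have h1 : -t * (2 * ((i : ℕ) : ℝ)) ≤ -t * ((l : ℝ) - 3) := mul_le_mul_of_nonneg_left (by linarith) ht0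
        nlinarith
      · have ht0' : -t ≤ 0 := le_of_lt (not_le.mp ht0)
        have : -t * ((i : ℕ) : ℝ) ≤ 0 := mul_nonpos_of_nonpos_of_nonneg ht0' hi0
        nlinarith
    have h1 : t / (2 * l) * (((i : ℕ) : ℝ) * (((i : ℕ) : ℝ) + 2)) = -(-t / (2 * l) * ((i : ℕ) : ℝ)) * (((i : ℕ) : ℝ) + 2) := by ring
    have h2 : 0 ≤ (((i : ℕ) : ℝ) + 2) * (4 + 2 * L - -t / (2 * l) * ((i : ℕ) : ℝ)) := mul_nonneg (by positivity) (by linarith)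
    nlinarith [h1, h2]
  · -- off the bad set the q-idele is a unit
    have h1 : ‖(exists_realising_qIdeles_pilotDataOfK T.D).choose pp x₀‖ = 1 :=
      (exists_realising_qIdeles_pilotDataOfK T.D).choose_spec.2.1 pp x₀ hS
    rw [h1, one_pow, mul_one] at hlt
    exact absurd hlt (not_lt.mpr (Real.one_le_rpow hp1.le hA0))

end Summit.ABC.IUTFork.Conditional

end
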